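import Literature.Analysis.Complex.GaussLucasGenusZero
import Literature.NumberTheory.LFunctions.XiDerivPositiveAxis
import Summits.RiemannHypothesis.RiemannHypothesis.Theorems.JensenPolynomialsLogBandXiSqRightHalfPlane
import Summits.RiemannHypothesis.RiemannHypothesis.Theorems.JensenPolynomialsChainDefs
import Summits.RiemannHypothesis.RiemannHypothesis.Theorems.JensenPolynomialsSqrtLogRange
import Literature.NumberTheory.LFunctions.ZetaFirstZeroCertificate
import HarnessLib

/-!
# No derivative `ξ₁⁽ⁿ⁾` of `ξ₁ = xiSq` vanishes on the closed right half-plane `Re z ≥ 0` (RH-FREE)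

Cell rh-jensen, LADDER-RH rung J-P(P3) «log band» (bears_on: route JensenLogBand, EDGE crux stub
`stub_edgeRight` and BAND crux stub `stub_rightOfAxis` — zone Z3 «right of the axis»). Line 1: RH-FREE;
WHAT THIS IS NOT: a zero-location theorem about the RH-free entire functions `ξ₁⁽ⁿ⁾`
(`ξ(s) = ξ₁((s-½)²)`); nothing here bears on zeros of `ζ` off the critical line or the truth of RH.

**Theorem** (`re_neg_of_iteratedDeriv_xiSq_eq_zero`, `iteratedDeriv_xiSq_ne_zero_of_re_nonneg`):
for EVERY `n ≥ 0`, every zero of `ξ₁⁽ⁿ⁾` has `Re z < 0`; equivalently `ξ₁⁽ⁿ⁾(z) ≠ 0` whenever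
`Re z ≥ 0`. No largeness of `n`, no radius condition. Sharper and still uniform in `n`
(`re_le_of_iteratedDeriv_xiSq_eq_zero`, `im_sq_add_re_le_of_iteratedDeriv_xiSq_eq_zero`): every zero
`w` of every `ξ₁⁽ⁿ⁾` has `Re w ≤ ¼ - 14²` (first zero of `ζ` above height `14`, tree `N(14) = 0`) and
`(Im w)² + Re w ≤ ¼` — the zeros of all `ξ₁⁽ⁿ⁾` lie in the closed convex hull of the zeros
`(ρ-½)²` of `ξ₁`.

Proof: GAUSS–LUCAS IN GENUS ZERO (tree `Literature.Analysis.Complex.re_neg_of_deriv_eq_zero`: for an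
entire `F` of order `< 1` with `F 0 ≠ 0`, not constant, if every zero of `F` has negative real part
then so does every zero of `F'` — `F'/F (z) = Σ 1/(z - aₖ)` over the genus-zero Hadamard product and
`Re 1/(z - aₖ) = Re (z - aₖ)/|z - aₖ|² > 0` on `Re z ≥ 0`), by induction on `n`: the base case `n = 0`
is the tree's `LogBand.re_neg_of_xiSq_eq_zero` (a zero `(ρ-½)²` of `ξ₁` with `Re ≥ 0` would need
`|Im ρ| < ½`; p475966), every `ξ₁⁽ⁿ⁾` is entire of order `< 1` (`isEntireOfOrderLtOne_iteratedDeriv_xiSq`,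
exponent `7/8`), and `ξ₁⁽ⁿ⁾(0) = γ(n)/8 > 0`, `(ξ₁⁽ⁿ⁾)'(0) = ξ₁⁽ⁿ⁺¹⁾(0) > 0`
(`iteratedDeriv_xiSq_ofReal_ne_zero_of_nonneg`, p473370).

**Consequences for the route's skeletons** (verbatim stub shapes, now for ALL shifts):
`stub_edgeRight_allShifts` (EDGE line `edge-region-split`: `∃ n₁ ∀ n ≥ n₁ ∀ z, ξ₁⁽ⁿ⁾ z = 0 →
chainRadius n ≤ ‖z‖ → ‖z‖ ≤ 64 (n/log n)² → 0 ≤ Re z → Im z = 0`, witness `n₁ = 0`) and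
`stub_rightOfAxis_allShifts` (BAND line `band-one-window`: `∀ κ > 0 ∃ n₃ ∀ n ≥ n₃ ∀ z, ξ₁⁽ⁿ⁾ z = 0 →
κ (n/log n)² ≤ ‖z‖ → 0 ≤ Re z → Im z = 0`, witness `n₃ = 0`): the one-saddle estimate planned for the
closed right half-plane is not needed — there is nothing there. (prover-rh-jensen-eng-2-g5-0, 2026-08-27.)
-/

noncomputable section

open Complex

set_option linter.dupNamespace false

namespace Summit.RiemannHypothesis.RiemannHypothesis.Theorems.JensenPolynomials.LogBand

open Literature.NumberTheory.LFunctions Literature.Analysis.Complex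

/-- No `ξ₁⁽ⁿ⁾` is constant: `(ξ₁⁽ⁿ⁾)'(0) = ξ₁⁽ⁿ⁺¹⁾(0) ≠ 0`. RH-FREE. -/
theorem exists_deriv_iteratedDeriv_xiSq_ne_zero (n : ℕ) :
    ∃ w : ℂ, deriv (iteratedDeriv n xiSq) w ≠ 0 :=
  ⟨0, by rw [← iteratedDeriv_succ]; exact KimLee.iteratedDeriv_xiSq_zero_ne (n + 1)⟩

/-- **Every zero of every `ξ₁⁽ⁿ⁾` lies in the open LEFT half-plane: `ξ₁⁽ⁿ⁾(z) = 0 → Re z < 0`**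
(all `n ≥ 0`; Gauss–Lucas in genus zero, induction on `n` from `ξ₁` itself). RH-FREE (the base case
uses the tree's kernel-certified RH up to height `101` only to exclude zeros of `ζ` with `|Im ρ| < ½`). -/
theorem re_neg_of_iteratedDeriv_xiSq_eq_zero (n : ℕ) {z : ℂ} (hz : iteratedDeriv n xiSq z = 0) :
    z.re < 0 := by
  induction n generalizing z with
  | zero =>
    rw [iteratedDeriv_zero] at hz
    exact re_neg_of_xiSq_eq_zero hz
  | succ n ih =>
    rw [iteratedDeriv_succ] at hz
    exact re_neg_of_deriv_eq_zero (isEntireOfOrderLtOne_iteratedDeriv_xiSq n)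
      (KimLee.iteratedDeriv_xiSq_zero_ne n) (exists_deriv_iteratedDeriv_xiSq_ne_zero n)
      (fun a ha => ih ha) hz

/-- **`ξ₁⁽ⁿ⁾(z) ≠ 0` for `Re z ≥ 0`, every `n ≥ 0`.** RH-FREE. -/
theorem iteratedDeriv_xiSq_ne_zero_of_re_nonneg (n : ℕ) {z : ℂ} (hz : 0 ≤ z.re) :
    iteratedDeriv n xiSq z ≠ 0 := fun h =>
  absurd (re_neg_of_iteratedDeriv_xiSq_eq_zero n h) (not_lt.2 hz)

/-- Stub tail, vacuously: a zero of `ξ₁⁽ⁿ⁾` with `Re z ≥ 0` is real (there is none). RH-FREE. -/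
theorem im_eq_zero_of_iteratedDeriv_xiSq_eq_zero_of_re_nonneg (n : ℕ) {z : ℂ}
    (hz : iteratedDeriv n xiSq z = 0) (hre : 0 ≤ z.re) : z.im = 0 :=
  absurd hz (iteratedDeriv_xiSq_ne_zero_of_re_nonneg n hre)

/-- All zeros of all `ξ₁⁽ⁿ⁾` lie in every closed half-plane `{Re (u z) ≤ c}` containing the zeros of
`ξ₁` — Gauss–Lucas iterated: the zeros of `ξ₁⁽ⁿ⁾` lie in the closed convex hull of the zeros
`(ρ-½)²` of `ξ₁`. RH-FREE. -/
theorem re_mul_le_of_iteratedDeriv_xiSq_eq_zero {u : ℂ} {c : ℝ}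
    (hzero : ∀ a : ℂ, xiSq a = 0 → (u * a).re ≤ c) (n : ℕ) {z : ℂ}
    (hz : iteratedDeriv n xiSq z = 0) : (u * z).re ≤ c := by
  induction n generalizing z with
  | zero =>
    rw [iteratedDeriv_zero] at hz
    exact hzero z hz
  | succ n ih =>
    rw [iteratedDeriv_succ] at hz
    exact re_mul_le_of_deriv_eq_zero (isEntireOfOrderLtOne_iteratedDeriv_xiSq n)
      (KimLee.iteratedDeriv_xiSq_zero_ne n) (exists_deriv_iteratedDeriv_xiSq_ne_zero n)
      (fun a ha => ih ha) hz

/-! ## The route's stub shapes, for all shifts -/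

/-- **EDGE skeleton `stub_edgeRight`, ALL SHIFTS** (route JensenLogBand, line `edge-region-split`,
verbatim stub type with witness `n₁ = 0`): zeros of `ξ₁⁽ⁿ⁾` in the edge annulus with `Re z ≥ 0` are
real — indeed absent. RH-FREE. -/
theorem stub_edgeRight_allShifts : ∃ n₁ : ℕ, ∀ n : ℕ, n₁ ≤ n → ∀ z : ℂ,
    iteratedDeriv n xiSq z = 0 → chainRadius n ≤ ‖z‖ → ‖z‖ ≤ 64 * ((n : ℝ) / Real.log n) ^ 2 →
      0 ≤ z.re → z.im = 0 :=
  ⟨0, fun n _ _ hz _ _ hre => im_eq_zero_of_iteratedDeriv_xiSq_eq_zero_of_re_nonneg n hz hre⟩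

/-- **BAND skeleton `stub_rightOfAxis`, ALL SHIFTS** (route JensenLogBand, line `band-one-window`,
verbatim stub type with `edgeScale n = (n/log n)²` unfolded and witness `n₃ = 0`): zeros of `ξ₁⁽ⁿ⁾`
with `κ (n/log n)² ≤ ‖z‖` and `Re z ≥ 0` are real — indeed absent, for every `κ`. RH-FREE. -/
theorem stub_rightOfAxis_allShifts : ∀ κ : ℝ, 0 < κ → ∃ n₃ : ℕ, ∀ n : ℕ, n₃ ≤ n → ∀ z : ℂ,
    iteratedDeriv n xiSq z = 0 → κ * ((n : ℝ) / Real.log (n : ℝ)) ^ 2 ≤ ‖z‖ → 0 ≤ z.re →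
      z.im = 0 :=
  fun _ _ => ⟨0, fun n _ _ hz _ hre => im_eq_zero_of_iteratedDeriv_xiSq_eq_zero_of_re_nonneg n hz hre⟩

/-- Radius-free, shift-free form for any line lead: `∀ n z, ξ₁⁽ⁿ⁾ z = 0 → 0 ≤ Re z → Im z = 0`.
RH-FREE. -/
theorem xiDeriv_rightOfAxis_all : ∀ (n : ℕ) (z : ℂ), iteratedDeriv n xiSq z = 0 → 0 ≤ z.re →
    z.im = 0 :=
  fun n _ hz hre => im_eq_zero_of_iteratedDeriv_xiSq_eq_zero_of_re_nonneg n hz hre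

/-! ## An `n`-uniform parabolic localisation of the zeros of all `ξ₁⁽ⁿ⁾` -/

/-- Every zero `a = (ρ-½)²` of `ξ₁` lies in the closed half-plane `Re a + 2t·Im a ≤ ¼ + t²`, for
every real `t` (tangent half-planes of the parabola `(Im a)² + Re a ≤ ¼`): with `δ = Re ρ - ½`,
`γ = Im ρ`, `Re a = δ² - γ²`, `Im a = 2δγ`, and `δ² ≤ ¼`. RH-FREE (uses only `0 < Re ρ < 1`). -/
theorem re_add_mul_im_le_of_xiSq_eq_zero (t : ℝ) {a : ℂ} (ha : xiSq a = 0) :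
    ((1 - 2 * t * I) * a).re ≤ 1 / 4 + t ^ 2 := by
  obtain ⟨ρ, -, h0, h1, hρ⟩ := Literature.Barriers.RiemannHypothesis.exists_zero_of_xiSq_eq_zero ha
  have hre : a.re = (ρ.re - 1 / 2) ^ 2 - ρ.im ^ 2 := by
    rw [← hρ]; simp [sq, Complex.mul_re]
  have him : a.im = 2 * (ρ.re - 1 / 2) * ρ.im := by
    rw [← hρ]; simp [sq, Complex.mul_im]; ring
  have hlin : ((1 - 2 * t * I) * a).re = a.re + 2 * t * a.im := by
    simp [Complex.mul_re]
  rw [hlin, hre, him]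
  have hδ : (ρ.re - 1 / 2) ^ 2 ≤ 1 / 4 := by nlinarith
  nlinarith [sq_nonneg (t - 2 * (ρ.re - 1 / 2) * ρ.im), sq_nonneg ρ.im,
    mul_nonneg (sub_nonneg.2 hδ) (sq_nonneg ρ.im)]

/-- **Parabolic localisation, uniform in `n`: every zero `w` of every `ξ₁⁽ⁿ⁾` satisfies
`(Im w)² + Re w ≤ ¼`** (the zeros of `ξ₁⁽ⁿ⁾` lie in the closed convex hull of the zeros `(ρ-½)²` of
`ξ₁`, which is inside the convex parabolic region `{(Im z)² + Re z ≤ ¼}`). RH-FREE. -/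
theorem im_sq_add_re_le_of_iteratedDeriv_xiSq_eq_zero (n : ℕ) {w : ℂ}
    (hw : iteratedDeriv n xiSq w = 0) : w.im ^ 2 + w.re ≤ 1 / 4 := by
  have h := re_mul_le_of_iteratedDeriv_xiSq_eq_zero (u := 1 - 2 * w.im * I) (c := 1 / 4 + w.im ^ 2)
    (fun a ha => re_add_mul_im_le_of_xiSq_eq_zero w.im ha) n hw
  have hlin : ((1 - 2 * (w.im : ℂ) * I) * w).re = w.re + 2 * w.im * w.im := by
    simp [Complex.mul_re]
  rw [hlin] at h
  nlinarith

/-- Hence `|Im w|² ≤ ¼ + ‖w‖` for every zero of every `ξ₁⁽ⁿ⁾` (compare the tree's Jensen-chain bound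
`|Im w| ≤ (1+√n) + √‖w‖`, which depends on `n`). RH-FREE. -/
theorem im_sq_le_of_iteratedDeriv_xiSq_eq_zero (n : ℕ) {w : ℂ}
    (hw : iteratedDeriv n xiSq w = 0) : w.im ^ 2 ≤ 1 / 4 + ‖w‖ := by
  have h := im_sq_add_re_le_of_iteratedDeriv_xiSq_eq_zero n hw
  have : -w.re ≤ ‖w‖ := by
    have := Complex.abs_re_le_norm w
    rw [abs_le] at this
    linarith [this.1]
  linarith

/-! ## An explicit `n`-uniform margin: `Re w ≤ ¼ - 14²` for every zero of every `ξ₁⁽ⁿ⁾` -/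

/-- Every zero `a = (ρ-½)²` of `ξ₁` has `Re a < ¼ - 14² = -783/4`: `Re a = (Re ρ-½)² - (Im ρ)²` and
`|Im ρ| > 14` by the tree's kernel-certified Backlund certificate `N(14) = 0`
(`riemannZeta_ne_zero_of_im_pos_of_im_le_fourteen`; conjugate zero for `Im ρ < 0`; no real zero in
`(0,1)`). RH-FREE. -/
theorem re_lt_of_xiSq_eq_zero {a : ℂ} (ha : xiSq a = 0) : a.re < -(783 / 4) := by
  obtain ⟨ρ, hζ, h0, h1, hρ⟩ := Literature.Barriers.RiemannHypothesis.exists_zero_of_xiSq_eq_zero ha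
  have hre : a.re = (ρ.re - 1 / 2) ^ 2 - ρ.im ^ 2 := by
    rw [← hρ]; simp [sq, Complex.mul_re]
  have hδ : (ρ.re - 1 / 2) ^ 2 < 1 / 4 := by nlinarith
  have him : 196 < ρ.im ^ 2 := by
    rcases lt_trichotomy ρ.im 0 with hneg | hzero | hpos
    · have h14 : ρ.im < -14 := by
        by_contra h
        rw [not_lt] at h
        exact riemannZeta_ne_zero_of_im_pos_of_im_le_fourteen (s := starRingEnd ℂ ρ)
          (by simpa using hneg) (by simp only [Complex.conj_im]; linarith)
          (Literature.NumberTheory.DiophantineGeometry.riemannZeta_conj_eq_zero hζ)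
      nlinarith
    · exact absurd hζ (riemannZeta_ne_zero_of_im_eq_zero_of_pos_of_lt_one hzero h0 h1)
    · have h14 : 14 < ρ.im := by
        by_contra h
        rw [not_lt] at h
        exact riemannZeta_ne_zero_of_im_pos_of_im_le_fourteen hpos h hζ
      nlinarith
  rw [hre]
  linarith

/-- **Every zero `w` of every `ξ₁⁽ⁿ⁾` has `Re w ≤ ¼ - 14² = -195.75`** (all `n`; Gauss–Lucas
iterated from `re_lt_of_xiSq_eq_zero`): every `ξ₁⁽ⁿ⁾` is zero-free on the half-plane
`Re z > -195.75`, uniformly in `n`. RH-FREE. -/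
theorem re_le_of_iteratedDeriv_xiSq_eq_zero (n : ℕ) {w : ℂ} (hw : iteratedDeriv n xiSq w = 0) :
    w.re ≤ -(783 / 4) := by
  have h := re_mul_le_of_iteratedDeriv_xiSq_eq_zero (u := 1) (c := -(783 / 4))
    (fun a ha => by simpa using (re_lt_of_xiSq_eq_zero ha).le) n hw
  simpa using h

/-! ## Strict versions: the zeros of every `ξ₁⁽ⁿ⁾` pull back to the OPEN critical strip
(appended 2026-08-27, same seat; RH-FREE) -/

/-- All zeros of all `ξ₁⁽ⁿ⁾` lie in every OPEN half-plane `{Re (u z) < c}` containing the zeros of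
`ξ₁` (Gauss–Lucas iterated, strict form). RH-FREE. -/
theorem re_mul_lt_of_iteratedDeriv_xiSq_eq_zero {u : ℂ} {c : ℝ}
    (hzero : ∀ a : ℂ, xiSq a = 0 → (u * a).re < c) (n : ℕ) {z : ℂ}
    (hz : iteratedDeriv n xiSq z = 0) : (u * z).re < c := by
  induction n generalizing z with
  | zero =>
    rw [iteratedDeriv_zero] at hz
    exact hzero z hz
  | succ n ih =>
    rw [iteratedDeriv_succ] at hz
    exact re_mul_lt_of_deriv_eq_zero (isEntireOfOrderLtOne_iteratedDeriv_xiSq n)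
      (KimLee.iteratedDeriv_xiSq_zero_ne n) (exists_deriv_iteratedDeriv_xiSq_ne_zero n)
      (fun a ha => ih ha) hz

/-- Strict tangent half-planes: every zero `a = (ρ-½)²` of `ξ₁` has `Re a + 2t·Im a < ¼ + t²` for
every real `t` (strictness from `(Re ρ - ½)² < ¼`). RH-FREE. -/
theorem re_add_mul_im_lt_of_xiSq_eq_zero (t : ℝ) {a : ℂ} (ha : xiSq a = 0) :
    ((1 - 2 * t * I) * a).re < 1 / 4 + t ^ 2 := by
  obtain ⟨ρ, -, h0, h1, hρ⟩ := Literature.Barriers.RiemannHypothesis.exists_zero_of_xiSq_eq_zero ha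
  have hre : a.re = (ρ.re - 1 / 2) ^ 2 - ρ.im ^ 2 := by
    rw [← hρ]; simp [sq, Complex.mul_re]
  have him : a.im = 2 * (ρ.re - 1 / 2) * ρ.im := by
    rw [← hρ]; simp [sq, Complex.mul_im]; ring
  have hlin : ((1 - 2 * t * I) * a).re = a.re + 2 * t * a.im := by
    simp [Complex.mul_re]
  rw [hlin, hre, him]
  have hδ : (ρ.re - 1 / 2) ^ 2 < 1 / 4 := by nlinarith
  nlinarith [sq_nonneg (t - 2 * (ρ.re - 1 / 2) * ρ.im), sq_nonneg ρ.im,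
    mul_nonneg (sub_nonneg.2 hδ.le) (sq_nonneg ρ.im)]

/-- **Strict parabola, uniform in `n`: every zero `w` of every `ξ₁⁽ⁿ⁾` has `(Im w)² + Re w < ¼`.**
RH-FREE. -/
theorem im_sq_add_re_lt_of_iteratedDeriv_xiSq_eq_zero (n : ℕ) {w : ℂ}
    (hw : iteratedDeriv n xiSq w = 0) : w.im ^ 2 + w.re < 1 / 4 := by
  have h := re_mul_lt_of_iteratedDeriv_xiSq_eq_zero (u := 1 - 2 * w.im * I) (c := 1 / 4 + w.im ^ 2)
    (fun a ha => re_add_mul_im_lt_of_xiSq_eq_zero w.im ha) n hw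
  have hlin : ((1 - 2 * (w.im : ℂ) * I) * w).re = w.re + 2 * w.im * w.im := by
    simp [Complex.mul_re]
  rw [hlin] at h
  nlinarith

/-! ## The `s`-plane reading: `ξ(s) = ξ₁((s-½)²)`; the map `s ↦ (s-½)²` carries the closed critical
strip onto the parabolic region `{(Im z)² + Re z ≤ ¼}` and the open strip onto its interior. -/

/-- **Critical strip for every row of the Jensen grid (uniform in `n`): if `ξ₁⁽ⁿ⁾((s-½)²) = 0` then
`0 < Re s < 1`.** (For `n = 0` these are the non-trivial zeros of `ζ`.) RH-FREE. -/
theorem re_mem_Ioo_of_iteratedDeriv_xiSq_sq_eq_zero (n : ℕ) {s : ℂ}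
    (hs : iteratedDeriv n xiSq ((s - 1 / 2) ^ 2) = 0) : 0 < s.re ∧ s.re < 1 := by
  have h := im_sq_add_re_lt_of_iteratedDeriv_xiSq_eq_zero n hs
  have hre : ((s - 1 / 2) ^ 2).re = (s.re - 1 / 2) ^ 2 - s.im ^ 2 := by
    simp [sq, Complex.mul_re]
  have him : ((s - 1 / 2) ^ 2).im = 2 * (s.re - 1 / 2) * s.im := by
    simp [sq, Complex.mul_im]; ring
  rw [hre, him] at h
  have hδ : (s.re - 1 / 2) ^ 2 < 1 / 4 := by
    nlinarith [sq_nonneg s.im, mul_nonneg (sq_nonneg (s.re - 1 / 2)) (sq_nonneg s.im)]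
  constructor <;> nlinarith

/-- In the `s`-plane, every zero of every `ξ₁⁽ⁿ⁾((s-½)²)` lies in the double cone
`|Re s - ½| < |Im s|` (from `Re (s-½)² < 0`). RH-FREE. -/
theorem abs_re_sub_half_lt_abs_im_of_iteratedDeriv_xiSq_sq_eq_zero (n : ℕ) {s : ℂ}
    (hs : iteratedDeriv n xiSq ((s - 1 / 2) ^ 2) = 0) : |s.re - 1 / 2| < |s.im| := by
  have h := re_neg_of_iteratedDeriv_xiSq_eq_zero n hs
  have hre : ((s - 1 / 2) ^ 2).re = (s.re - 1 / 2) ^ 2 - s.im ^ 2 := by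
    simp [sq, Complex.mul_re]
  rw [hre] at h
  exact sq_lt_sq.1 (by linarith)

/-- In the `s`-plane, every zero of every `ξ₁⁽ⁿ⁾((s-½)²)` has `(Im s)² ≥ 783/4 + (Re s - ½)²`, in
particular `|Im s| > 13.99` (from `Re (s-½)² ≤ ¼ - 14²`, the first zero of `ζ`). RH-FREE. -/
theorem im_sq_ge_of_iteratedDeriv_xiSq_sq_eq_zero (n : ℕ) {s : ℂ}
    (hs : iteratedDeriv n xiSq ((s - 1 / 2) ^ 2) = 0) :
    783 / 4 + (s.re - 1 / 2) ^ 2 ≤ s.im ^ 2 := by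
  have h := re_le_of_iteratedDeriv_xiSq_eq_zero n hs
  have hre : ((s - 1 / 2) ^ 2).re = (s.re - 1 / 2) ^ 2 - s.im ^ 2 := by
    simp [sq, Complex.mul_re]
  rw [hre] at h
  linarith

end Summit.RiemannHypothesis.RiemannHypothesis.Theorems.JensenPolynomials.LogBand
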